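import Summits.CriticalPhenomena.SAWScalingLimit.Theorems.SAWLoopFugacityFlowIsingBoundaryRatioWindowRectConnectA
import Summits.CriticalPhenomena.SAWScalingLimit.Theorems.SAWLoopFugacityFlowIsingBoundaryRatioWindowRectShadow
import HarnessLib

/-!
# Window rectangle: the bulk is in `E`, and rim darts exist
(line `fk-anchor-transfer`, crux `IsingBoundaryRatio`, stmt-CriticalPhenomena-10650; helper file of the stub
`windowRectPresentation_holds : WindowRectPresentation`)

In the static setting `X : WSetting`, using the shadowing of chart paths (`WSetting.hshadow`) along the
arc–axis–arc paths of `…WindowRectConnectA`: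
* `exists_walk_in_band` — two sites with chart points of radius in `[a, b]` (inside the bulk region) and not too
  small imaginary part are joined by a walk of the mesh graph through points of `D` of chart radius in
  `[a - κ, b + κ]`;
* `bulk_mem` — the field `bulk_mem` of `IsWindowRect`: every vertex of `Ω_δ` of the inner window with chart point
  in the cone `|re| ≤ im` is a vertex of `E` (it is joined to the base site through window sites);
* `exists_O_dart`, `exists_I_dart` — external darts of `E` whose missing edge is an `Ω_δ`-edge towards a site of
  chart radius `> w₂`, resp. `< w₁` (last vertex of `E` along a walk from the base site to a site of chart
  radius `≈ w₂ + 2m`, resp. `≈ w₁ - 2m`).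
[folklore]
-/

noncomputable section

open scoped Classical Topology Real
open Filter Set Metric Complex
open Literature.Probability.LatticeModels Literature.Probability.RandomPlanarGeometry
open Literature.Probability.LatticeModels.DiscreteRect Literature.Topology.PlaneTopology
open UpperHalfPlane (upperHalfPlaneSet)

namespace Summit.CriticalPhenomena.SAWScalingLimit.Theorems.IsingBoundaryRatio

namespace WindowRect

/-- **Along a walk from a vertex off `P` to a vertex in `P` there is an adjacent pair off/in `P`.** [folklore] -/
theorem exists_adj_pair_of_walk {V : Type*} {G : SimpleGraph V} (P : V → Prop) :
    ∀ {u v : V} (W : G.Walk u v), ¬ P u → P v →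
      ∃ t w : V, G.Adj t w ∧ ¬ P t ∧ P w ∧ t ∈ W.support ∧ w ∈ W.support := by
  intro u v W
  induction W with
  | nil => intro hu hv; exact absurd hv hu
  | @cons a b c h W ih =>
    intro ha hc
    by_cases hb : P b
    · exact ⟨a, b, h, ha, hb, by simp, by simp⟩
    · obtain ⟨t, w, htw, ht, hw, hts, hws⟩ := ih hb hc
      exact ⟨t, w, htw, ht, hw, by simp [hts], by simp [hws]⟩

namespace WSetting

variable (X : WSetting)

/-! ### Walks in a chart band -/

/-- **Two sites of the bulk region are joined through points of a chart band.** If the chart points `w, w'` of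
the sites `z, z'` (mesh points in `D`) have radius in `[a, b] ⊆ [r₁ + m, r₂ - m]` and imaginary parts, like
`a`, at least `(r₁ + 4m)/20`, there is a walk of the mesh graph from `z` to `z'` through points of `D` of chart
radius in `[a - κ, b + κ]`. [folklore] -/
theorem exists_walk_in_band {z z' : Site 2} (hz : meshPoint X.δ z ∈ X.D.carrier) (hz' : meshPoint X.δ z' ∈ X.D.carrier)
    {a b : ℝ} (ha : X.r₁ + X.m ≤ a) (hb : b ≤ X.r₂ - X.m)
    (haz : a ≤ ‖X.φ.symm (meshPoint X.δ z)‖) (hbz : ‖X.φ.symm (meshPoint X.δ z)‖ ≤ b)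
    (haz' : a ≤ ‖X.φ.symm (meshPoint X.δ z')‖) (hbz' : ‖X.φ.symm (meshPoint X.δ z')‖ ≤ b)
    (hh : (X.r₁ + 4 * X.m) / 20 ≤ a) (hhz : (X.r₁ + 4 * X.m) / 20 ≤ (X.φ.symm (meshPoint X.δ z)).im)
    (hhz' : (X.r₁ + 4 * X.m) / 20 ≤ (X.φ.symm (meshPoint X.δ z')).im) :
    ∃ W : (meshGraph X.D.carrier X.δ).Walk z z', ∀ s ∈ W.support, meshPoint X.δ s ∈ X.D.carrier ∧
      a - X.κ ≤ X.rad s ∧ X.rad s ≤ b + X.κ := by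
  obtain ⟨γ, hγ⟩ := exists_path_arc_axis_arc (X.im_pos hz) (X.im_pos hz')
  have hreg : ∀ t, X.r₁ + X.m ≤ ‖γ t‖ ∧ ‖γ t‖ ≤ X.r₂ - X.m ∧ (X.r₁ + 4 * X.m) / 20 ≤ (γ t).im := by
    intro t
    obtain ⟨h1, h2, h3⟩ := hγ t
    refine ⟨ha.trans ((le_min haz haz').trans h1), (h2.trans (max_le hbz hbz')).trans hb, le_trans ?_ h3⟩
    exact le_min (le_min hhz hhz') (le_min (hh.trans haz) (hh.trans haz'))
  obtain ⟨W, hW⟩ := X.hshadow z z' hz hz' γ hreg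
  refine ⟨W, fun s hs => ?_⟩
  obtain ⟨hsD, t, ht⟩ := hW s hs
  obtain ⟨h1, h2, -⟩ := hγ t
  have hn := abs_norm_sub_norm_le (X.φ.symm (meshPoint X.δ s)) (γ t)
  rw [← dist_eq_norm] at hn
  have hn' := abs_le.1 (hn.trans ht)
  refine ⟨hsD, ?_, ?_⟩ <;> rw [rad_def]
  · linarith [(le_min haz haz').trans h1]
  · linarith [h2.trans (max_le hbz hbz')]

/-! ### The base site -/

/-- The chart point of the base site: radius and imaginary part within `κ` of `r⋆`. [folklore] -/
theorem base_chart : |X.rad X.z₀ - X.rstar| ≤ X.κ ∧ X.rstar - X.κ ≤ (X.φ.symm (meshPoint X.δ X.z₀)).im := by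
  refine ⟨X.abs_rad_z₀_sub_le, ?_⟩
  have h := X.hz₀c
  rw [Complex.dist_eq] at h
  have him := (abs_im_le_norm _).trans h
  rw [Complex.sub_im] at him
  have e : ((((X.r₁' + X.r₂') / 2 : ℝ) : ℂ) * I).im = X.rstar := by simp [rstar_def]
  rw [e] at him
  linarith [(abs_le.1 him).1]

/-- The mesh point of the base site lies in `D`. [folklore] -/
theorem base_mem : meshPoint X.δ X.z₀ ∈ X.D.carrier := X.meshPoint_mem X.hz₀

/-- Useful numerology of the radii. [folklore] -/
theorem radii' : 0 < X.m ∧ 0 < X.κ ∧ 100 * X.κ ≤ X.m ∧ 0 < X.r₁ ∧ X.w₁ = X.r₁ + 4 * X.m ∧ X.w₂ = X.r₂ - 4 * X.m ∧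
    X.rstar = (X.r₁' + X.r₂') / 2 ∧ X.r₁ + 8 * X.m ≤ X.r₁' ∧ X.r₁' < X.r₂' ∧ X.r₂' + 8 * X.m ≤ X.r₂ :=
  ⟨X.hm, X.hκ, X.hκm, X.r₁_pos, rfl, rfl, rfl, X.hr₁, X.hr₁₂, X.hr₂'⟩

/-! ### Bulk sites of `S` are vertices of `E` -/

/-- **A site of `S` in the bulk region, of chart radius in `[w₁ + κ, w₂ - κ]`, is a vertex of `E`**: its
lattice neighbour `x + e₀` is a window site joined to it. [folklore] -/
theorem mem_verts_of_mem_S_bulk {x : Site 2} (hxS : x ∈ X.S) (h1 : X.w₁ + X.κ ≤ X.rad x) (h2 : X.rad x ≤ X.w₂ - X.κ)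
    (him : (X.r₁ + 4 * X.m) / 20 ≤ (X.φ.symm (meshPoint X.δ x)).im) : x ∈ verts X.E := by
  obtain ⟨hm, hκ, hκm, hr₁, hw₁, hw₂, hrs, hr₁', hr₁₂, hr₂'⟩ := X.radii'
  have hxD : meshPoint X.δ x ∈ X.D.carrier := X.meshPoint_mem (X.mem_meshDomain_of_mem_S hxS)
  have hball : closedBall (meshPoint X.δ x) (2 * X.δ) ⊆ X.D.carrier := by
    have h := X.hbulk (X.φ.symm (meshPoint X.δ x)) (by rw [← rad_def]; linarith) (by rw [← rad_def]; linarith) him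
    rwa [X.φ.apply_symm_apply hxD] at h
  set y : Site 2 := x + dir 0 with hy
  have hdxy : dist (meshPoint X.δ x) (meshPoint X.δ y) = X.δ := dist_meshPoint_add_dir X.hδ x 0
  have hyD : meshPoint X.δ y ∈ X.D.carrier := hball (mem_closedBall.2 (by rw [dist_comm, hdxy]; linarith [X.hδ]))
  have hzd : (zdGraph 2).Adj x y := by
    rw [Literature.Probability.Percolation.zdGraph_two_adj_iff]; simp [hy, dir]
  have hmesh : (meshGraph X.D.carrier X.δ).Adj x y := by
    refine meshGraph_adj_iff.2 ⟨hzd, ?_⟩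
    refine ((convex_closedBall _ _).segment_subset (mem_closedBall_self (by linarith [X.hδ])) ?_).trans
      (hball.trans subset_closure)
    exact mem_closedBall.2 (by rw [dist_comm, hdxy]; linarith [X.hδ])
  have hymesh : y ∈ meshDomain X.D.carrier X.δ :=
    (forall_mem_meshDomain_of_walk (SimpleGraph.Walk.cons hmesh SimpleGraph.Walk.nil) (X.mem_meshDomain_of_mem_S hxS)
      (by intro s hs; simp at hs; rcases hs with rfl | rfl <;> assumption)) y (by simp)
  have hrad := X.abs_rad_sub_rad_le hxD hyD hzd (by linarith)
  rw [abs_le] at hrad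
  have hyW : y ∈ X.Wset := ⟨hymesh, by linarith [hrad.1], by linarith [hrad.2]⟩
  have hadj : (discreteDomainGraph X.D.carrier X.δ).Adj x y :=
    discreteDomainGraph_adj_iff.2 ⟨hmesh, X.mem_meshDomain_of_mem_S hxS, hymesh⟩
  exact X.mem_verts_E_of_mem_S hxS (X.mem_S_of_adj hxS hadj hyW) hadj

/-- The base site is a vertex of `E`. [folklore] -/
theorem z₀_mem_verts : X.z₀ ∈ verts X.E := by
  obtain ⟨hm, hκ, hκm, hr₁, hw₁, hw₂, hrs, hr₁', hr₁₂, hr₂'⟩ := X.radii'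
  obtain ⟨hb1, hb2⟩ := X.base_chart
  rw [abs_le] at hb1
  exact X.mem_verts_of_mem_S_bulk X.z₀_mem_S (by linarith [hb1.1]) (by linarith [hb1.2]) (by linarith)

/-! ### The bulk is in `E` -/

/-- **`bulk_mem`**: a vertex of `Ω_δ` of chart radius in `[r₁' - 2κ…]`, precisely in `[r₁', r₂']`, with chart
point in the cone `|re| ≤ im`, is in `S` and is a vertex of `E`. [folklore] -/
theorem mem_verts_of_cone {x : Site 2} (hx : x ∈ meshDomain X.D.carrier X.δ) (h1 : X.r₁' ≤ X.rad x)
    (h2 : X.rad x ≤ X.r₂') (hcone : |(X.φ.symm (meshPoint X.δ x)).re| ≤ (X.φ.symm (meshPoint X.δ x)).im) :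
    x ∈ X.S ∧ x ∈ verts X.E := by
  obtain ⟨hm, hκ, hκm, hr₁, hw₁, hw₂, hrs, hr₁', hr₁₂, hr₂'⟩ := X.radii'
  obtain ⟨hb1, hb2⟩ := X.base_chart
  rw [abs_le] at hb1
  have hxD := X.meshPoint_mem hx
  -- the imaginary part of the chart point of `x` is at least `rad x / 2`
  have him : X.rad x / 2 ≤ (X.φ.symm (meshPoint X.δ x)).im := by
    set w := X.φ.symm (meshPoint X.δ x) with hw
    have hi : 0 < w.im := X.im_pos hxD
    have hn : ‖w‖ ^ 2 = w.re ^ 2 + w.im ^ 2 := by rw [← Complex.normSq_eq_norm_sq, Complex.normSq_apply]; ring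
    have hre : w.re ^ 2 ≤ w.im ^ 2 := by
      have := abs_le.1 hcone; nlinarith
    have hn0 : 0 ≤ ‖w‖ := norm_nonneg w
    rw [rad_def, ← hw]
    nlinarith
  -- the walk from the base site
  obtain ⟨W, hW⟩ := X.exists_walk_in_band X.base_mem hxD (a := X.r₁' - X.κ) (b := X.r₂' + X.κ) (by linarith)
    (by linarith) (by rw [← rad_def]; linarith) (by rw [← rad_def]; linarith) (by rw [← rad_def]; linarith)
    (by rw [← rad_def]; linarith) (by linarith) (by linarith) (by linarith)
  have hmeshD : ∀ s ∈ W.support, s ∈ meshDomain X.D.carrier X.δ :=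
    forall_mem_meshDomain_of_walk W X.hz₀ fun s hs => (hW s hs).1
  have hWset : ∀ s ∈ W.support, s ∈ X.Wset := fun s hs =>
    ⟨hmeshD s hs, by linarith [(hW s hs).2.1], by linarith [(hW s hs).2.2]⟩
  obtain ⟨hxS, hxv⟩ := X.mem_S_of_walk W X.z₀_mem_S hWset
  refine ⟨hxS, ?_⟩
  rcases hxv with rfl | hxv
  · exact X.z₀_mem_verts
  · exact hxv

/-- **`bulk_mem`** in the form of `IsWindowRect`. [folklore] -/
theorem bulk_mem : ∀ (x : Site 2) (hx : x ∈ X.Λ), x ∈ meshDomain X.D.carrier X.δ →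
    (⟨x, hx⟩ : ↥X.Λ) ∈ annWindow X.D X.φ X.M X.ε X.δ X.ρ X.r₁' X.r₂' X.Λ →
    |(X.φ.symm (meshPoint X.δ x)).re| ≤ (X.φ.symm (meshPoint X.δ x)).im → x ∈ verts X.E := by
  intro x _ hx hwin hcone
  obtain ⟨-, h1, h2⟩ := hwin
  exact (X.mem_verts_of_cone hx (by rw [rad_def]; exact h1) (by rw [rad_def]; exact h2) hcone).2

/-! ### Rim darts exist -/

/-- The site nearest to the image of a bulk chart point: in `D`, with chart point within `κ`. [folklore] -/
theorem nearestSite_bulk {w : ℂ} (h1 : X.r₁ + X.m ≤ ‖w‖) (h2 : ‖w‖ ≤ X.r₂ - X.m) (h3 : (X.r₁ + 4 * X.m) / 20 ≤ w.im) :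
    meshPoint X.δ (nearestSite X.δ (X.φ w)) ∈ X.D.carrier ∧
      dist (X.φ.symm (meshPoint X.δ (nearestSite X.δ (X.φ w)))) w ≤ X.κ := by
  obtain ⟨hm, hκ, hκm, hr₁, hw₁, hw₂, hrs, hr₁', hr₁₂, hr₂'⟩ := X.radii'
  have hwH : w ∈ upperHalfPlaneSet := show 0 < w.im by linarith
  have hPD : X.φ w ∈ X.D.carrier := X.φ.mapsTo hwH
  have hball := X.hbulk w h1 h2 h3
  have hd : dist (meshPoint X.δ (nearestSite X.δ (X.φ w))) (X.φ w) ≤ X.δ := dist_meshPoint_nearestSite_le X.hδ _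
  have hzD : meshPoint X.δ (nearestSite X.δ (X.φ w)) ∈ X.D.carrier := hball (mem_closedBall.2 (by linarith [X.hδ]))
  refine ⟨hzD, ?_⟩
  have h := X.osc' hPD (z' := meshPoint X.δ (nearestSite X.δ (X.φ w))) (by rw [X.φ.symm_apply_apply hwH]; linarith)
    hzD (by rw [dist_comm]; linarith [X.hδ])
  rw [X.φ.symm_apply_apply hwH] at h
  exact h

/-- From an adjacent pair (vertex of `E`, non-vertex of `E`) of vertices of `Ω_δ`: an external dart of `E` whose
missing edge is an edge of `Ω_δ` towards a site off the window. [folklore] -/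
theorem extDart_of_pair {t w : Site 2} (htw : (meshGraph X.D.carrier X.δ).Adj t w) (ht : t ∉ verts X.E)
    (hw : w ∈ verts X.E) (htm : t ∈ meshDomain X.D.carrier X.δ) (hwm : w ∈ meshDomain X.D.carrier X.δ) :
    ∃ k : Fin 4, t = w + dir k ∧ IsExtDart X.E (w, k) ∧ (discreteDomainGraph X.D.carrier X.δ).Adj w (w + dir k) ∧
      (X.rad t < X.w₁ ∨ X.w₂ < X.rad t) := by
  have hzd : (zdGraph 2).Adj w t := (meshGraph_adj_iff.1 htw.symm).1
  obtain ⟨k, hk⟩ := exists_eq_add_dir_of_adj hzd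
  have hadj : (discreteDomainGraph X.D.carrier X.δ).Adj w t := discreteDomainGraph_adj_iff.2 ⟨htw.symm, hwm, htm⟩
  have hnot : s(w, t) ∉ X.E := fun h => ht (mem_verts_of_mem h)
  refine ⟨k, hk, ⟨hw, by rw [← hk]; exact hnot⟩, by rw [← hk]; exact hadj, ?_⟩
  -- `t` is not a window site: otherwise it would be in `S` and a vertex of `E`
  have hwS : w ∈ X.S := X.mem_S_of_mem_bdVerts ⟨k, hw, by rw [← hk]; exact hnot⟩
  by_contra hcon
  push Not at hcon
  have htW : t ∈ X.Wset := ⟨htm, hcon.1, hcon.2⟩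
  have htS : t ∈ X.S := X.mem_S_of_adj hwS hadj htW
  exact ht (X.mem_verts_E_of_mem_S htS hwS hadj.symm)

/-- **An outer rim dart exists**: an external dart of `E` whose missing edge is an edge of `Ω_δ` towards a site
of chart radius `> w₂`. [folklore] -/
theorem exists_O_dart : ∃ d : Site 2 × Fin 4, IsExtDart X.E d ∧
    (discreteDomainGraph X.D.carrier X.δ).Adj d.1 (d.1 + dir d.2) ∧ X.w₂ < X.rad (d.1 + dir d.2) := by
  obtain ⟨hm, hκ, hκm, hr₁, hw₁, hw₂, hrs, hr₁', hr₁₂, hr₂'⟩ := X.radii'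
  obtain ⟨hb1, hb2⟩ := X.base_chart
  rw [abs_le] at hb1
  -- the target site
  set w : ℂ := (((X.w₂ + 2 * X.m : ℝ)) : ℂ) * I with hw
  have hwn : ‖w‖ = X.w₂ + 2 * X.m := by
    rw [hw, norm_mul, norm_I, mul_one, norm_real, Real.norm_eq_abs, abs_of_pos (by linarith)]
  have hwi : w.im = X.w₂ + 2 * X.m := by simp [hw]
  obtain ⟨hzD, hzw⟩ := X.nearestSite_bulk (w := w) (by rw [hwn]; linarith) (by rw [hwn]; linarith) (by rw [hwi]; linarith)
  set z := nearestSite X.δ (X.φ w) with hz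
  have hzn := abs_norm_sub_norm_le (X.φ.symm (meshPoint X.δ z)) w
  rw [← dist_eq_norm, hwn] at hzn
  have hzn' := abs_le.1 (hzn.trans hzw)
  have hzi : X.w₂ + 2 * X.m - X.κ ≤ (X.φ.symm (meshPoint X.δ z)).im := by
    have h := (abs_im_le_norm _).trans (le_of_eq_of_le (dist_eq_norm _ _).symm hzw)
    rw [Complex.sub_im, hwi] at h
    linarith [(abs_le.1 h).1]
  have hzv : z ∉ verts X.E := fun h => by
    have := (X.vertex_facts h).2.2; rw [rad_def] at this; linarith [hzn'.1]
  -- the walk from the base site to `z`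
  obtain ⟨W, hW⟩ := X.exists_walk_in_band X.base_mem hzD (a := X.rstar - X.κ) (b := X.w₂ + 2 * X.m + X.κ)
    (by linarith) (by linarith) (by rw [← rad_def]; linarith [hb1.1]) (by rw [← rad_def]; linarith [hb1.2])
    (by linarith [hzn'.1]) (by linarith [hzn'.2]) (by linarith) (by linarith) (by linarith)
  have hmeshD : ∀ s ∈ W.support, s ∈ meshDomain X.D.carrier X.δ :=
    forall_mem_meshDomain_of_walk W X.hz₀ fun s hs => (hW s hs).1
  obtain ⟨t, v, htv, ht, hv, hts, hvs⟩ :=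
    exists_adj_pair_of_walk (fun s => s ∈ verts X.E) W.reverse hzv X.z₀_mem_verts
  rw [SimpleGraph.Walk.support_reverse, List.mem_reverse] at hts hvs
  obtain ⟨k, rfl, hext, hadj, hrad⟩ := X.extDart_of_pair htv ht hv (hmeshD t hts) (hmeshD v hvs)
  refine ⟨(v, k), hext, hadj, ?_⟩
  rcases hrad with h | h
  · linarith [(hW _ hts).2.1]
  · exact h

/-- **An inner rim dart exists**: an external dart of `E` whose missing edge is an edge of `Ω_δ` towards a site
of chart radius `< w₁`. [folklore] -/
theorem exists_I_dart : ∃ d : Site 2 × Fin 4, IsExtDart X.E d ∧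
    (discreteDomainGraph X.D.carrier X.δ).Adj d.1 (d.1 + dir d.2) ∧ X.rad (d.1 + dir d.2) < X.w₁ := by
  obtain ⟨hm, hκ, hκm, hr₁, hw₁, hw₂, hrs, hr₁', hr₁₂, hr₂'⟩ := X.radii'
  obtain ⟨hb1, hb2⟩ := X.base_chart
  rw [abs_le] at hb1
  set w : ℂ := (((X.w₁ - 2 * X.m : ℝ)) : ℂ) * I with hw
  have hwn : ‖w‖ = X.w₁ - 2 * X.m := by
    rw [hw, norm_mul, norm_I, mul_one, norm_real, Real.norm_eq_abs, abs_of_pos (by linarith)]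
  have hwi : w.im = X.w₁ - 2 * X.m := by simp [hw]
  obtain ⟨hzD, hzw⟩ := X.nearestSite_bulk (w := w) (by rw [hwn]; linarith) (by rw [hwn]; linarith) (by rw [hwi]; linarith)
  set z := nearestSite X.δ (X.φ w) with hz
  have hzn := abs_norm_sub_norm_le (X.φ.symm (meshPoint X.δ z)) w
  rw [← dist_eq_norm, hwn] at hzn
  have hzn' := abs_le.1 (hzn.trans hzw)
  have hzi : X.w₁ - 2 * X.m - X.κ ≤ (X.φ.symm (meshPoint X.δ z)).im := by
    have h := (abs_im_le_norm _).trans (le_of_eq_of_le (dist_eq_norm _ _).symm hzw)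
    rw [Complex.sub_im, hwi] at h
    linarith [(abs_le.1 h).1]
  have hzv : z ∉ verts X.E := fun h => by
    have := (X.vertex_facts h).2.1; rw [rad_def] at this; linarith [hzn'.2]
  obtain ⟨W, hW⟩ := X.exists_walk_in_band X.base_mem hzD (a := X.w₁ - 2 * X.m - X.κ) (b := X.rstar + X.κ)
    (by linarith) (by linarith) (by rw [← rad_def]; linarith [hb1.1]) (by rw [← rad_def]; linarith [hb1.2])
    (by linarith [hzn'.1]) (by linarith [hzn'.2]) (by linarith) (by linarith) (by linarith)
  have hmeshD : ∀ s ∈ W.support, s ∈ meshDomain X.D.carrier X.δ :=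
    forall_mem_meshDomain_of_walk W X.hz₀ fun s hs => (hW s hs).1
  obtain ⟨t, v, htv, ht, hv, hts, hvs⟩ :=
    exists_adj_pair_of_walk (fun s => s ∈ verts X.E) W.reverse hzv X.z₀_mem_verts
  rw [SimpleGraph.Walk.support_reverse, List.mem_reverse] at hts hvs
  obtain ⟨k, rfl, hext, hadj, hrad⟩ := X.extDart_of_pair htv ht hv (hmeshD t hts) (hmeshD v hvs)
  refine ⟨(v, k), hext, hadj, ?_⟩
  rcases hrad with h | h
  · exact h
  · linarith [(hW _ hts).2.2]

end WSetting

end WindowRect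

/-- **The bulk is in the window edge set** (field `bulk_mem` of `IsWindowRect`), closed form (registered sub-goal
of stmt-CriticalPhenomena-10650). [folklore] -/
theorem windowRect_bulk_mem : ∀ (X : WindowRect.WSetting) (x : Site 2) (hx : x ∈ X.Λ), x ∈ meshDomain X.D.carrier X.δ → (⟨x, hx⟩ : ↥X.Λ) ∈ annWindow X.D X.φ X.M X.ε X.δ X.ρ X.r₁' X.r₂' X.Λ → |(X.φ.symm (meshPoint X.δ x)).re| ≤ (X.φ.symm (meshPoint X.δ x)).im → x ∈ DiscreteRect.verts X.E :=
  fun X => X.bulk_mem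

end Summit.CriticalPhenomena.SAWScalingLimit.Theorems.IsingBoundaryRatio

end
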